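/-
Copyright (c) 2026 the pub-hodgecm-mathlib formalisation cell (harness21).  Prover seat hodgecm-mathlib-K2E1-p08 (g3), Track B ∕ K2-LIT
(build stream 29), h413 = `stmt-HodgeConjecture-24833`, line `K2_E1_TraceFormulaBeta`, row 10 (DEAL F ∕ G1 rung c: the archimedean twist `ε_∞`);
dealer K2E1-plan (g2) RULING «G1 GO» 2026-09-04T01:27:06Z.  2026-09-04.
-/
import Summits.HodgeConjecture.HodgeConjecture.Theorems.K2E1TwistEpsilonInvolution   -- ★ p856522 (K2E1-p08 g3) G1 rung a: `unitaryTwist_apply`, `map_unitaryTwist`, `unitaryTwist_unitaryTwist`, hermitian transport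
import Literature.NumberTheory.Rogawski1990.ArchSmoothCongruence                    -- ★ `expGL_units_conj`, `IsArchSmooth.comp_units_conj` (the template)
import Literature.NumberTheory.Automorphic.HeckeIntegrandPureTensorDualOnBox          -- ★ `toMixed_glTransposeInv`
import HarnessLib

/-!
# h413 ∕ Track B «K2-LIT», line `K2_E1_TraceFormulaBeta`, row 10 (G1 rung c) — `K2E1TwistEpsilonArch`: the ARCHIMEDEAN twist `ε_∞(g) = Φ_∞⁻¹((σ_∞g)ᵀ)⁻¹Φ_∞` of
# `G̃(E ⊗ ℝ) = GL_n(E ⊗_ℚ ℝ)` — `ε_∞(exp X) = exp(dε X)`, smoothness in the archimedean variable is preserved by `φ ↦ φ ∘ ε_∞`, and `(ε g)_∞ = ε_∞(g_∞)`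

Cell `pub/hodgecm-mathlib`, crux H413 = `stmt-HodgeConjecture-24833`, route of record `HCCMUnconditional`; chair K2-lead (g0), dealer K2E1-plan (g2) (RULING «G1 GO»
2026-09-04T01:27:06Z).  Third rung of G1 (after ★ p856522 rung a: functoriality ∕ involutivity; ★ p856539 rung b: levels a.e.): the ARCHIMEDEAN component of the twist of
`G̃ = Res_{E∕F} GL_n` [Rogawski1990 §3.10, §4.7], `ε_∞ := unitaryTwist (conjMixed F E c) Φ_∞` on `GL_n(E ⊗ ℝ)` (★ `conjMixed` = `c ⊗ 1` on `E ⊗_ℚ ℝ = mixedSpace E`), which is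
what the archimedean factor `φ_∞` of a twisted pure tensor (★ `GlobalTestFunctionGt`) is composed with.  We PROVE: (i) `ε_∞(exp X) = exp(Φ_∞⁻¹ · (−(σ_∞X)ᵀ) · Φ_∞)` (★
`map_conjMixed_exp`, Mathlib `Matrix.exp_transpose` ∕ `Matrix.exp_neg`, ★ `expGL_units_conj`); (ii) **`IsArchSmooth (φ ∘ ε_∞)` from `IsArchSmooth φ`** for the full archimedean group
★ `archGroupGL n E` (the differential `dε : X ↦ Φ_∞⁻¹(−(σ_∞X)ᵀ)Φ_∞` is real-linear and `ε_∞(g · exp X) = ε_∞(g) · exp(dε X)`; proof = ★ `IsArchSmooth.comp_units_conj` with `dε` for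
`Ad(T⁻¹)`); (iii) continuity of `ε_∞`, `ε_∞ ∘ ε_∞ = id` for `σ_∞`-hermitian `Φ_∞` and `c² = 1` (★ `conjMixed_inv_apply`), hence compact support is preserved; (iv) COMPATIBILITY with the adelic twist:
`(c ⊗ 1)` and `g ↦ g_∞` commute (`toMixed_map_conjAdele`), so **`(ε g)_∞ = ε_∞(g_∞)`** (`toMixed_twistAdelic`, ★ `toMixed_glTransposeInv`) with `Φ_∞ = (Φ ⊗ 1)_∞`, which is
`σ_∞`-hermitian when `Φ` is `c`-hermitian (`map_toMixed_formAdelic_conjMixed_transpose`).  THEOREMS ONLY (no `def`, no `instance`, no `notation`, no named-fact hypothesis, no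
`sorry`); lane `--kind proof --supports stmt-HodgeConjecture-24833 --as helper`.  Next (last) rung: the `twist` of ★ `GlobalTestFunctionGt` (a Defs leaf, R6).

HONEST LABEL.  Count-neutral helper; closes no socket by itself; HC_CM is proved only modulo the 7 printed citations (2 remaining named inputs: hLiu418 =
`stmt-HodgeConjecture-24832`, h413 = `stmt-HodgeConjecture-24833`) until rung 0 closes.

## References
* [Rogawski1990] J. D. Rogawski, *Automorphic Representations of Unitary Groups in Three Variables* (1990), §3.10 p. 33, §4.7 p. 47, §4.10 p. 57; §2.1 p. 12 (`ρ(ε)`).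
* [BorelJacquet1979] A. Borel, H. Jacquet, *Automorphic forms and automorphic representations*, PSPM 33.1 (1979), §1.1, §4.1 (smoothness in `x_∞`).
* [Knapp2002] A. W. Knapp, *Lie Groups Beyond an Introduction* (2002), I §10 (1.83) (`exp(Ad(g)X) = g exp(X) g⁻¹`).
-/

set_option autoImplicit false
-- the mandated namespace repeats `HodgeConjecture.HodgeConjecture`, as in every `Theorems/*.lean` of this sub-problem
set_option linter.dupNamespace false

noncomputable section

open NumberField NumberField.mixedEmbedding IsDedekindDomain Set Filter Topology
-- `Classical`: the Mathlib normed-space instances on `mixedSpace E` (note H5 of ★ `AdelicGLnGlue`, as in ★ `ArchSmoothCongruence`)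
open scoped MatrixGroups Matrix Matrix.Norms.Operator ContDiff Classical

namespace Summit.HodgeConjecture.HodgeConjecture.Cruxes.H413.K2E1TwistEpsilonArch

open Literature.NumberTheory.Automorphic Literature.NumberTheory.Automorphic.UnitaryGroup
open Literature.NumberTheory.Rogawski1990.Ch4Sec10 (unitaryTwist)
open Literature.NumberTheory.GaloisRepresentations (glTransposeInv coe_glTransposeInv_apply)
open Summit.HodgeConjecture.HodgeConjecture.Cruxes.H413.K2E1GlobalTestFunctionsTwisted
open Summit.HodgeConjecture.HodgeConjecture.Cruxes.H413.K2E1TwistEpsilonInvolution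

variable (F E : Type) [Field F] [NumberField F] [Field E] [NumberField E] [Algebra F E] (n : ℕ) (c : E ≃ₐ[F] E)

/-! ## §1 The archimedean twist `ε_∞` on `GL_n(E ⊗ ℝ)` -/

section Arch

variable (Φ : GL (Fin n) (mixedSpace E))

omit [NumberField F] in
/-- **`ε_∞(exp X) = exp(dε X)`, `dε X = Φ_∞⁻¹ · (−(σ_∞ X)ᵀ) · Φ_∞`**: entrywise `σ_∞ = c ⊗ 1` commutes with the matrix exponential (★ `map_conjMixed_exp`), `((exp Y)ᵀ)⁻¹ = exp(−Yᵀ)`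
(Mathlib `Matrix.exp_transpose`, `Matrix.exp_neg`), and `Φ⁻¹ exp(Z) Φ = exp(Φ⁻¹ZΦ)` (★ `expGL_units_conj`). [cite: Knapp2002, I §10 (1.83)] [cite: Rogawski1990, §3.10 p. 33] -/
theorem unitaryTwist_conjMixed_expGL (X : Matrix (Fin n) (Fin n) (mixedSpace E)) :
    unitaryTwist (conjMixed F E c) Φ (expGL X) =
      expGL (((Φ⁻¹ : GL (Fin n) (mixedSpace E)) : Matrix (Fin n) (Fin n) (mixedSpace E)) * (-(X.map (conjMixed F E c))ᵀ) *
        (Φ : Matrix (Fin n) (Fin n) (mixedSpace E))) := by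
  -- `σ_∞ (exp X) = exp (σ_∞ X)` in `GL_n`
  have h1 : Matrix.GeneralLinearGroup.map (conjMixed F E c) (expGL X) = expGL (X.map (conjMixed F E c)) :=
    Units.ext (by
      change (NormedSpace.exp X).map (conjMixed F E c) = NormedSpace.exp (X.map (conjMixed F E c))
      exact map_conjMixed_exp F E c n X)
  -- `((exp Y)ᵀ)⁻¹ = exp (−Yᵀ)` in `GL_n`
  have h2 : ∀ Y : Matrix (Fin n) (Fin n) (mixedSpace E), glTransposeInv (Fin n) (mixedSpace E) (expGL Y) = expGL (-Yᵀ) := fun Y =>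
    Units.ext (by
      rw [coe_glTransposeInv_apply, Matrix.coe_units_inv, coe_expGL, coe_expGL, Matrix.transpose_nonsing_inv, ← Matrix.exp_transpose, ← Matrix.exp_neg])
  rw [unitaryTwist_apply, inv_inv, h1, h2, expGL_units_conj]

omit [NumberField F] [NumberField E] in
/-- **`ε_∞` is continuous** (★ `continuous_conjMixed`, Mathlib `Continuous.generalLinearGroup_map`, ★ `glTransposeInv` continuous). [cite: BorelJacquet1979, §4.1] -/
theorem continuous_unitaryTwist_conjMixed : Continuous (unitaryTwist (conjMixed F E c) Φ) := by
  change Continuous fun g => Φ⁻¹ * glTransposeInv (Fin n) (mixedSpace E) (Matrix.GeneralLinearGroup.map (conjMixed F E c) g) * Φ⁻¹⁻¹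
  exact (continuous_const.mul ((glTransposeInv (Fin n) (mixedSpace E)).continuous.comp (continuous_conjMixed F E c).generalLinearGroup_map)).mul continuous_const

omit [NumberField F] in
/-- **SMOOTHNESS IN THE ARCHIMEDEAN VARIABLE IS PRESERVED BY `φ ↦ φ ∘ ε_∞`** on `GL_n(E ⊗ ℝ)` (★ `IsArchSmooth` for the full group ★ `archGroupGL n E`): `ε_∞(g · exp X) =
ε_∞(g) · exp(dε X)` (`unitaryTwist_conjMixed_expGL`) with the REAL-LINEAR `dε : X ↦ Φ_∞⁻¹(−(σ_∞X)ᵀ)Φ_∞` (★ `conjMixed_real_smul`), so `X ↦ (φ ∘ ε_∞)(g · exp X) = φ(ε_∞ g · exp(dε X))` is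
`C^∞` as a composite of a `C^∞` map with a continuous linear map — the proof of ★ `IsArchSmooth.comp_units_conj` with `Ad(T⁻¹)` replaced by `dε`.  This is the archimedean-smoothness clause of
the twist `φ_∞ ↦ φ_∞ ∘ ε_∞` of a twisted pure tensor. [cite: BorelJacquet1979, §1.1, §4.1] [cite: Knapp2002, I §10 (1.83)] [cite: Rogawski1990, §2.1 p. 12; §4.10 p. 57] -/
theorem isArchSmooth_comp_unitaryTwist_conjMixed {φ : GL (Fin n) (mixedSpace E) → ℂ} (hφ : IsArchSmooth (archGroupGL n E).carrier.subtype φ) :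
    IsArchSmooth (archGroupGL n E).carrier.subtype (φ ∘ unitaryTwist (conjMixed F E c) Φ) := by
  intro g
  -- Mathlib idiom (Mathlib/Algebra/Lie/OfAssociative.lean), needed to mention the Lie algebra `𝔤𝔩_n = ⊤` of ★ `archGroupGL` (as in ★ `ArchSmoothCongruence`; no attribute)
  letI : LieRing (Matrix (Fin n) (Fin n) (mixedSpace E)) := LieRing.ofAssociativeRing
  -- the differential `dε : X ↦ Φ⁻¹ (−(σX)ᵀ) Φ` on the Lie algebra `⊤`
  let Lm : (archGroupGL n E).lie.toSubmodule →ₗ[ℝ] (archGroupGL n E).lie.toSubmodule :=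
    { toFun := fun X => ⟨((Φ⁻¹ : GL (Fin n) (mixedSpace E)) : Matrix (Fin n) (Fin n) (mixedSpace E)) *
          (-((X : Matrix (Fin n) (Fin n) (mixedSpace E)).map (conjMixed F E c))ᵀ) * (Φ : Matrix (Fin n) (Fin n) (mixedSpace E)), by simp [archGroupGL_lie]⟩
      map_add' := fun X Y => by
        ext1
        have hadd : ((X : Matrix (Fin n) (Fin n) (mixedSpace E)) + (Y : Matrix (Fin n) (Fin n) (mixedSpace E))).map (conjMixed F E c) =
            (X : Matrix (Fin n) (Fin n) (mixedSpace E)).map (conjMixed F E c) + (Y : Matrix (Fin n) (Fin n) (mixedSpace E)).map (conjMixed F E c) :=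
          Matrix.map_add _ (map_add (conjMixed F E c)) _ _
        simp only [Submodule.coe_add, hadd, Matrix.transpose_add, neg_add, Matrix.mul_add, Matrix.add_mul]
      map_smul' := fun r X => by
        ext1
        have hsm : ((r • (X : Matrix (Fin n) (Fin n) (mixedSpace E))).map (conjMixed F E c)) = r • (X : Matrix (Fin n) (Fin n) (mixedSpace E)).map (conjMixed F E c) :=
          Matrix.ext fun i j => by simp only [Matrix.map_apply, Matrix.smul_apply, conjMixed_real_smul]
        simp only [Submodule.coe_smul, RingHom.id_apply, hsm, Matrix.transpose_smul, ← smul_neg, Matrix.mul_smul, Matrix.smul_mul] }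
  haveI : FiniteDimensional ℝ (Matrix (Fin n) (Fin n) (mixedSpace E)) := Module.Finite.matrix
  haveI : FiniteDimensional ℝ (archGroupGL n E).lie.toSubmodule := inferInstance
  have hLsmooth : ContDiff ℝ ∞ (Lm : (archGroupGL n E).lie.toSubmodule → (archGroupGL n E).lie.toSubmodule) :=
    (⟨Lm, Lm.continuous_of_finiteDimensional⟩ : (archGroupGL n E).lie.toSubmodule →L[ℝ] (archGroupGL n E).lie.toSubmodule).contDiff
  have heq : (fun X : (archGroupGL n E).lie.toSubmodule =>
      (φ ∘ unitaryTwist (conjMixed F E c) Φ) (g * (archGroupGL n E).carrier.subtype ((archGroupGL n E).expMem ⟨X, X.2⟩))) =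
      (fun Y : (archGroupGL n E).lie.toSubmodule =>
        φ (unitaryTwist (conjMixed F E c) Φ g * (archGroupGL n E).carrier.subtype ((archGroupGL n E).expMem ⟨Y, Y.2⟩))) ∘ (Lm : _ → _) := by
    funext X
    simp only [Function.comp_apply, Subgroup.coe_subtype, RealMatrixGroup.coe_expMem, map_mul]
    congr 2
    exact unitaryTwist_conjMixed_expGL F E n c Φ (X : Matrix (Fin n) (Fin n) (mixedSpace E))
  rw [heq]
  exact (hφ (unitaryTwist (conjMixed F E c) Φ g)).comp hLsmooth

omit [NumberField F] [NumberField E] in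
/-- **`ε_∞ ∘ ε_∞ = id`** for `c² = 1` and a `σ_∞`-hermitian `Φ_∞` (`(Φ_∞ᵀ).map σ_∞ = Φ_∞`) — ★ p856522 `unitaryTwist_unitaryTwist` over `E ⊗ ℝ`. [cite: Rogawski1990, §3.10 p. 33] -/
theorem unitaryTwist_conjMixed_unitaryTwist_conjMixed (hc : c * c = 1)
    (hΦ : ((Φ : GL (Fin n) (mixedSpace E)) : Matrix (Fin n) (Fin n) (mixedSpace E))ᵀ.map (conjMixed F E c) = (Φ : Matrix (Fin n) (Fin n) (mixedSpace E)))
    (g : GL (Fin n) (mixedSpace E)) : unitaryTwist (conjMixed F E c) Φ (unitaryTwist (conjMixed F E c) Φ g) = g := by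
  -- `(c ⊗ 1)² = 1` on `E ⊗ ℝ` (★ `conjMixed_inv_apply` with `c⁻¹ = c`; = ★ `UnitaryGroup.conjMixed_conjMixed`, not imported to keep the import light)
  have hσ : ∀ x : mixedSpace E, conjMixed F E c (conjMixed F E c x) = x := fun x => by
    have hinv : c⁻¹ = c := inv_eq_of_mul_eq_one_right hc
    have h := conjMixed_inv_apply F E c x
    rwa [hinv] at h
  exact unitaryTwist_unitaryTwist (conjMixed F E c) hσ hΦ g

omit [NumberField F] [NumberField E] in
/-- **Compact support is preserved by `φ ↦ φ ∘ ε_∞`** (`ε_∞` is an involutive homeomorphism: continuous with `ε_∞ ∘ ε_∞ = id`; Mathlib `HasCompactSupport.comp_homeomorph`).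
[cite: BorelJacquet1979, §4.1] -/
theorem hasCompactSupport_comp_unitaryTwist_conjMixed (hc : c * c = 1)
    (hΦ : ((Φ : GL (Fin n) (mixedSpace E)) : Matrix (Fin n) (Fin n) (mixedSpace E))ᵀ.map (conjMixed F E c) = (Φ : Matrix (Fin n) (Fin n) (mixedSpace E)))
    {φ : GL (Fin n) (mixedSpace E) → ℂ} (hφ : HasCompactSupport φ) : HasCompactSupport (φ ∘ unitaryTwist (conjMixed F E c) Φ) := by
  let e : GL (Fin n) (mixedSpace E) ≃ₜ GL (Fin n) (mixedSpace E) :=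
    { toFun := unitaryTwist (conjMixed F E c) Φ
      invFun := unitaryTwist (conjMixed F E c) Φ
      left_inv := unitaryTwist_conjMixed_unitaryTwist_conjMixed F E n c Φ hc hΦ
      right_inv := unitaryTwist_conjMixed_unitaryTwist_conjMixed F E n c Φ hc hΦ
      continuous_toFun := continuous_unitaryTwist_conjMixed F E n c Φ
      continuous_invFun := continuous_unitaryTwist_conjMixed F E n c Φ }
  exact hφ.comp_homeomorph e

omit [NumberField F] [NumberField E] in
/-- Continuity is preserved by `φ ↦ φ ∘ ε_∞`. [cite: BorelJacquet1979, §4.1] -/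
theorem continuous_comp_unitaryTwist_conjMixed {φ : GL (Fin n) (mixedSpace E) → ℂ} (hφ : Continuous φ) :
    Continuous (φ ∘ unitaryTwist (conjMixed F E c) Φ) :=
  hφ.comp (continuous_unitaryTwist_conjMixed F E n c Φ)

end Arch

/-! ## §2 Compatibility with the adelic twist: `(ε g)_∞ = ε_∞(g_∞)` -/

section Adelic

variable (Φ : GL (Fin n) E)

omit [NumberField F] in
/-- **`(c ⊗ 1)` commutes with `g ↦ g_∞`**: `toMixed (σ g) = σ_∞ (toMixed g)` (entrywise: ★ `AdeleRing.smul_fst`, ★ `conjMixed_ringEquiv`). [cite: BorelJacquet1979, §4.1] -/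
theorem toMixed_map_conjAdele (g : GL (Fin n) (AdeleRing (𝓞 E) E)) :
    GLn.toMixed n E (Matrix.GeneralLinearGroup.map (conjAdele F E c) g) = Matrix.GeneralLinearGroup.map (conjMixed F E c) (GLn.toMixed n E g) := by
  refine Matrix.GeneralLinearGroup.ext fun i j => ?_
  rw [GLn.coe_toMixed_apply, Matrix.GeneralLinearGroup.map_apply, Matrix.GeneralLinearGroup.map_apply, GLn.coe_toMixed_apply, conjAdele_apply,
    AdeleRing.smul_fst, conjMixed_ringEquiv]

omit [NumberField F] in
/-- **`(ε g)_∞ = ε_∞(g_∞)`**: the archimedean component of the adelic twist ★ `twistAdelic F E n Φ c` is the archimedean twist with `Φ_∞ = (Φ ⊗ 1)_∞` (`toMixed` is a homomorphism;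
★ `toMixed_glTransposeInv`; `toMixed_map_conjAdele`). [cite: Rogawski1990, §4.7 p. 47] [cite: BorelJacquet1979, §4.1] -/
theorem toMixed_twistAdelic (g : GL (Fin n) (AdeleRing (𝓞 E) E)) :
    GLn.toMixed n E (twistAdelic F E n Φ c g) = unitaryTwist (conjMixed F E c) (GLn.toMixed n E (formAdelic E n Φ)) (GLn.toMixed n E g) := by
  rw [twistAdelic_apply, unitaryTwist_apply, map_mul, map_mul, map_inv, map_inv, map_inv, toMixed_glTransposeInv, toMixed_map_conjAdele]

omit [NumberField F] in
/-- **`Φ_∞ = (Φ ⊗ 1)_∞` is `σ_∞`-hermitian when `Φ` is `c`-hermitian** (the adelic statement ★ p856522 `map_formAdelic_conjAdele_transpose` read on archimedean components).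
[cite: Rogawski1990, §1.9 p. 8] -/
theorem map_toMixed_formAdelic_conjMixed_transpose (hΦ : ((Φ : GL (Fin n) E) : Matrix (Fin n) (Fin n) E)ᵀ.map c = (Φ : Matrix (Fin n) (Fin n) E)) :
    (((GLn.toMixed n E (formAdelic E n Φ) : GL (Fin n) (mixedSpace E)) : Matrix (Fin n) (Fin n) (mixedSpace E))ᵀ).map (conjMixed F E c) =
      ((GLn.toMixed n E (formAdelic E n Φ) : GL (Fin n) (mixedSpace E)) : Matrix (Fin n) (Fin n) (mixedSpace E)) := by
  have h := map_formAdelic_conjAdele_transpose F E n Φ c hΦ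
  refine Matrix.ext fun i j => ?_
  have hij := congrFun (congrFun h i) j
  rw [Matrix.map_apply, Matrix.transpose_apply] at hij ⊢
  rw [GLn.coe_toMixed_apply, GLn.coe_toMixed_apply, ← hij, conjAdele_apply, AdeleRing.smul_fst, conjMixed_ringEquiv]

omit [NumberField F] in
/-- **Summary for the twist of a twisted pure tensor**: for `c² = 1`, `Φ` `c`-hermitian and a test factor `φ_∞` on `GL_n(E ⊗ ℝ)` that is continuous, compactly supported and smooth in
the archimedean variable, `φ_∞ ∘ ε_∞` (with `Φ_∞ = (Φ ⊗ 1)_∞`) has the same three properties — the archimedean clause of `twist : GlobalTestFunctionGt → GlobalTestFunctionGt`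
(next rung, a Defs leaf). [cite: Rogawski1990, §4.10 p. 57; §2.1 p. 12] [cite: BorelJacquet1979, §4.1] -/
theorem arch_comp_twist_clauses (hc : c * c = 1) (hΦ : ((Φ : GL (Fin n) E) : Matrix (Fin n) (Fin n) E)ᵀ.map c = (Φ : Matrix (Fin n) (Fin n) E))
    {φ : GL (Fin n) (mixedSpace E) → ℂ} (hφc : Continuous φ) (hφs : HasCompactSupport φ) (hφa : IsArchSmooth (archGroupGL n E).carrier.subtype φ) :
    Continuous (φ ∘ unitaryTwist (conjMixed F E c) (GLn.toMixed n E (formAdelic E n Φ))) ∧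
      HasCompactSupport (φ ∘ unitaryTwist (conjMixed F E c) (GLn.toMixed n E (formAdelic E n Φ))) ∧
        IsArchSmooth (archGroupGL n E).carrier.subtype (φ ∘ unitaryTwist (conjMixed F E c) (GLn.toMixed n E (formAdelic E n Φ))) :=
  ⟨continuous_comp_unitaryTwist_conjMixed F E n c _ hφc,
    hasCompactSupport_comp_unitaryTwist_conjMixed F E n c _ hc (map_toMixed_formAdelic_conjMixed_transpose F E n c Φ hΦ) hφs,
    isArchSmooth_comp_unitaryTwist_conjMixed F E n c _ hφa⟩

end Adelic

end Summit.HodgeConjecture.HodgeConjecture.Cruxes.H413.K2E1TwistEpsilonArch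

end
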